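import Summits.BirchSwinnertonDyer.BirchSwinnertonDyer.Theorems.PrintCf2SplitBadTwoSplitPrimeLineSaturationAnyP
import Summits.BirchSwinnertonDyer.BirchSwinnertonDyer.Theorems.EisensteinPrimesAnomalousTowerTorsionCore
import Literature.NumberTheory.EllipticCurves.AnticyclotomicPrimeDecompositionAboveProofs
import Summits.BirchSwinnertonDyer.BirchSwinnertonDyer.Theorems.SignedBaseChangeAnticyclotomicEisensteinDivisibilityAnticyclotomicNonsplit
import HarnessLib

/-!
# The DOUBLY-ADAPTED generator pair at a split prime: THE `ℤ_p`-line unramified outside `v` and THE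
# `ℤ_p`-line unramified outside `v̄` TOGETHER generate the `ℤ_p²`-tower, with generators in the inertia groups
# (crux `SplitBadTwoRankOneOfFacts`, stmt-BirchSwinnertonDyer-20368; LEAD cf2-p1 g13 ASSIGN 2026-08-29T02:40:23Z, fallback brick)

Width seat `bsd-line-cf2-p1-w2` g13.  For `K` imaginary quadratic, `p` a prime with `p ∤ h_K`, and finite
places `v ≠ v̄` of `K`: if `κ₁` is a `ℤ_p`-extension unramified outside `v` and `κ₂` one unramified outside `v̄`
(Agboola's lines `K(v^∞)`, `K(v̄^∞) = K*_∞`; they EXIST when `p = v v̄` splits, `ZpExtension.exists_isUnramifiedOutside_of_split`),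
then there are `γ₁ ∈ I_v`, `γ₂ ∈ I_{v̄}` with `IsTopGeneratorPair κ₁ κ₂ γ₁ γ₂` — i.e. `(κ₁, κ₂) : Γ_K → ℤ_p²` is
JOINTLY ONTO and the pair is adapted on BOTH sides (`γ₁ ∈ ker κ₂`, `γ₂ ∈ ker κ₁`), with the generators taken
inside the (chosen) inertia groups.  The road-α frame supplies of the crux (`RubinValueTwoV10.frameSupply_two_v10a/b_of_quadraticPart`,
LEAD g13) adapt only the second coordinate (`κ₂` unramified outside `v̄`, `κ₁` = SOME partner from
`GeneratorPairSupply.exists_isTopGeneratorPair_of_isTopGenerator_two`); this brick lets a later supply take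
`κ₁ :=` THE line unramified outside `v` (LEAD: «drop the any-partner detour»).

The one arithmetic input is **total ramification**: `exists_mem_inertia_isTopGenerator_of_isUnramifiedOutside` —
THE line unramified outside `v` maps every inertia group `I_𝔓`, `𝔓 ∣ v`, ONTO `ℤ_p` when `p ∤ h_K`.  Proof: if no
element of `I_𝔓` is a topological generator then, `κ(I_𝔓)` being `ℤ_p`-saturated
(`AnomalousLocalTorsion.exists_mem_apply_eq_ofAdd_mul`, closed inertia `absIntegers.isClosed_inertia_holds`),
`κ(I_𝔓) ⊆ pℤ_p`; the inertia groups at the other primes above `v` are conjugate (`ZpExtension.exists_mem_inertia_apply_eq`)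
and those away from `v` lie in `ker κ` (`SplitPrimeLine.inertia_le_kerSubgroup_of_isUnramifiedOutside`), so every
inertia group lies in `κ⁻¹(pℤ_p)`: the first layer `K₁/K` — abelian of degree `p` (`finrank_layer_holds`,
`isAbelianGalois_layer`) — is unramified at all finite places (the tree's per-layer
`SignedBaseChangeAcDivAnticyclotomicNonsplit.isUnramifiedIn_layer_of_forall_inertia_le_layerSubgroup`) and at the infinite ones (`K` totally
complex), hence `p = [K₁ : K] ∣ h_K` (`hilbertClassField.finrank_dvd_classNumber_of_abelian`, Cox Cor. 5.24) — absurd.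
Then `γ₁ ∈ I_𝔓 ≤ ker κ₂` (κ₂ unramified outside `v̄ ≠ v`) and symmetrically.

* **`exists_mem_inertia_isTopGenerator_of_isUnramifiedOutside`** — total ramification of THE `v`-line above `v` (`p ∤ h_K`);
* **`exists_isTopGeneratorPair_of_isUnramifiedOutside`** — the doubly-adapted pair with `γ₁ ∈ I_𝔓`, `γ₂ ∈ I_{𝔓'}` for ANY
  primes `𝔓 ∣ v`, `𝔓' ∣ v̄` of `\bar ℤ_K`; `exists_isTopGeneratorPair_inertia_of_isUnramifiedOutside` — the same with the tree's
  CHOSEN inertia groups `GreenbergSelmer.inertia v / vbar` (the frame currency);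
* **`exists_doublyAdapted_isTopGeneratorPair_of_split`** — existence package at a split `p = v v̄`; `…_two` — the `p = 2`
  display in the binder shape of the crux's frames (`¬ 2 ∣ NumberField.classNumber K`, `v, v̄ ∣ 2`, `v̄ ≠ v`).

Theorems only; no definition, no named fact, no `sorry`, no instance; hypothesis-free (standard axioms).  HONEST
FRAMING: `ℤ_p`-linear bookkeeping on class field theory already proved in the tree (Hilbert class field, the split
lines); closes nothing by itself (`--supports`); beyond-print theorem: no (de Shalit II.4.17 / Greenberg 1978 §4:
«`K_∞ = K(𝔭^∞)K(𝔭̄^∞)`» when `p ∤ h_K`).  No summit statement / BSD / the crux is proved here.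

References: [deShalit1987] II.1.8, II.4.17 (p. 77); [Greenberg1978] §4 p. 94; [Washington1997] §13.1, Prop. 13.2,
Thm. 13.4; [Cox2013] §5.C Cor. 5.24; [Agboola2007] §1 p. 1.
-/

set_option linter.dupNamespace false
set_option autoImplicit false

noncomputable section

open scoped NumberField
open NumberField IsDedekindDomain Field
open Literature Literature.NumberTheory.GaloisRepresentations Literature.NumberTheory.EllipticCurves
open Literature.NumberTheory.NumberFields
open Summit.BirchSwinnertonDyer.BirchSwinnertonDyer.Theorems.PrintCf2
open Summit.BirchSwinnertonDyer.BirchSwinnertonDyer.Theorems.PrintCf2.SplitPrimeLine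

namespace Summit.BirchSwinnertonDyer.BirchSwinnertonDyer.Theorems.PrintCf2.DoublyAdaptedPair

variable {p : ℕ} [Fact p.Prime] {K : Type} [Field K] [NumberField K]

/-- **THE `ℤ_p`-line unramified outside `v` is TOTALLY RAMIFIED above `v` when `p ∤ h_K`**: for `K` imaginary
quadratic, `κ` a `ℤ_p`-extension unramified outside `v` and ANY prime `𝔓 ∣ v` of `\bar ℤ_K`, some `τ ∈ I_𝔓` is a
topological generator (`κ τ = 1 ∈ ℤ_p`), i.e. `κ(I_𝔓) = ℤ_p`.  Otherwise `κ(I_𝔓) ⊆ pℤ_p` (saturation of the image of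
the closed subgroup `I_𝔓`), every inertia group lies in `κ⁻¹(pℤ_p)` (conjugates above `v`; `ker κ` away from `v`), and
the first layer is an everywhere unramified abelian extension of degree `p` of the totally complex `K`, so `p ∣ h_K`
(Hilbert class field). [cite: deShalit1987, II.1.8 and II.4.17 (p. 77)] [cite: Washington1997, §13.1 Prop. 13.2, Thm. 13.4]
[cite: Cox2013, §5.C Cor. 5.24] -/
theorem exists_mem_inertia_isTopGenerator_of_isUnramifiedOutside (hK : IsImaginaryQuadratic K)
    (hh : ¬ p ∣ NumberField.classNumber K) {κ : ZpExtension K p} {v : HeightOneSpectrum (𝓞 K)}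
    (hκ : κ.IsUnramifiedOutside v) {𝔓 : Ideal (absIntegers (𝓞 K) K)} (h𝔓 : 𝔓 ∈ v.primesAbove) :
    ∃ τ ∈ 𝔓.inertia (absoluteGaloisGroup K), κ.IsTopGenerator τ := by
  by_contra hno
  push Not at hno
  have hp : p.Prime := Fact.out
  -- (1) every element of `I_𝔓` has `κ`-value divisible by `p`
  have hdiv : ∀ τ ∈ 𝔓.inertia (absoluteGaloisGroup K), (p : ℤ_[p]) ∣ (κ τ).toAdd := by
    intro τ hτ
    by_contra hnd
    have hnorm : ‖(κ τ).toAdd‖ = 1 :=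
      le_antisymm (PadicInt.norm_le_one _)
        (not_lt.mp fun hlt ↦ hnd ((PadicInt.norm_lt_one_iff_dvd _).mp hlt))
    obtain ⟨u, hu⟩ := PadicInt.isUnit_iff.mpr hnorm
    obtain ⟨τ', hτ', hκτ'⟩ := AnomalousLocalTorsion.exists_mem_apply_eq_ofAdd_mul κ
      (𝔓.inertia (absoluteGaloisGroup K)) (absIntegers.isClosed_inertia_holds (R := 𝓞 K) (K := K) 𝔓)
      hτ ((u⁻¹ : ℤ_[p]ˣ) : ℤ_[p])
    refine hno τ' hτ' ?_
    rw [ZpExtension.IsTopGenerator, hκτ', ← hu, Units.inv_mul]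
  -- (2) every inertia group lies in `layerSubgroup 1`
  have hI : ∀ (w : HeightOneSpectrum (𝓞 K)) (𝔔 : Ideal (absIntegers (𝓞 K) K)),
      𝔔 ∈ w.primesAbove → 𝔔.inertia (absoluteGaloisGroup K) ≤ κ.layerSubgroup 1 := by
    intro w 𝔔 h𝔔 τ hτ
    by_cases hw : w = v
    · subst hw
      obtain ⟨τ₀, hτ₀, h1, -⟩ := ZpExtension.exists_mem_inertia_apply_eq κ κ h𝔓 h𝔔 hτ
      rw [ZpExtension.mem_layerSubgroup, pow_one, ← h1]
      exact hdiv τ₀ hτ₀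
    · exact κ.kerSubgroup_le_layerSubgroup 1 (inertia_le_kerSubgroup_of_isUnramifiedOutside hκ hw h𝔔 hτ)
  -- (3) the first layer is abelian of degree `p`, unramified everywhere: `p ∣ h_K`
  haveI : FiniteDimensional K (κ.layer 1) := κ.finiteDimensional_layer_holds 1
  haveI : IsGalois K (κ.layer 1) := κ.isGalois_layer_holds 1
  haveI : IsAbelianGalois K (κ.layer 1) := κ.isAbelianGalois_layer 1
  haveI : NumberField (κ.layer 1) := NumberField.of_module_finite K (κ.layer 1)
  have himag : ∀ w : InfinitePlace K, w.IsComplex := fun w ↦ hK.2.isComplex w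
  haveI : IsUnramifiedAtInfinitePlaces K (κ.layer 1) :=
    ⟨fun w ↦ (InfinitePlace.isUnramified_iff).mpr (Or.inr (himag _))⟩
  have h := hilbertClassField.finrank_dvd_classNumber_of_abelian K (κ.layer 1)
    (fun w ↦ SignedBaseChangeAcDivAnticyclotomicNonsplit.isUnramifiedIn_layer_of_forall_inertia_le_layerSubgroup
      κ 1 hI w)
  rw [κ.finrank_layer_holds 1, pow_one] at h
  exact hh h

/-- **THE DOUBLY-ADAPTED GENERATOR PAIR** (`K` imaginary quadratic, `p ∤ h_K`, `v̄ ≠ v`): for `κ₁` unramified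
outside `v`, `κ₂` unramified outside `v̄` and ANY primes `𝔓 ∣ v`, `𝔓' ∣ v̄` of `\bar ℤ_K` there are `γ₁ ∈ I_𝔓`,
`γ₂ ∈ I_{𝔓'}` with `IsTopGeneratorPair κ₁ κ₂ γ₁ γ₂` (`κ₁ γ₁ = 1`, `γ₁ ∈ ker κ₂`, `γ₂ ∈ ker κ₁`, `κ₂ γ₂ = 1`): total
ramification gives the generators inside inertia, and `I_𝔓 ≤ ker κ₂`, `I_{𝔓'} ≤ ker κ₁` by unramifiedness at the
other prime.  In particular `(κ₁, κ₂) : Γ_K → ℤ_p²` is jointly onto: `K̃_∞ = K(v^∞)·K(v̄^∞)`.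
[cite: deShalit1987, II.4.17 (p. 77)] [cite: Greenberg1978, §4 p. 94] [cite: Washington1997, Thm. 13.4] -/
theorem exists_isTopGeneratorPair_of_isUnramifiedOutside (hK : IsImaginaryQuadratic K)
    (hh : ¬ p ∣ NumberField.classNumber K) {v vbar : HeightOneSpectrum (𝓞 K)} (hne : vbar ≠ v)
    {κ₁ κ₂ : ZpExtension K p} (hκ₁ : κ₁.IsUnramifiedOutside v) (hκ₂ : κ₂.IsUnramifiedOutside vbar)
    {𝔓 𝔓' : Ideal (absIntegers (𝓞 K) K)} (h𝔓 : 𝔓 ∈ v.primesAbove) (h𝔓' : 𝔓' ∈ vbar.primesAbove) :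
    ∃ γ₁ ∈ 𝔓.inertia (absoluteGaloisGroup K), ∃ γ₂ ∈ 𝔓'.inertia (absoluteGaloisGroup K),
      ZpExtension.IsTopGeneratorPair κ₁ κ₂ γ₁ γ₂ := by
  obtain ⟨γ₁, hγ₁, hg₁⟩ := exists_mem_inertia_isTopGenerator_of_isUnramifiedOutside hK hh hκ₁ h𝔓
  obtain ⟨γ₂, hγ₂, hg₂⟩ := exists_mem_inertia_isTopGenerator_of_isUnramifiedOutside hK hh hκ₂ h𝔓'
  exact ⟨γ₁, hγ₁, γ₂, hγ₂, hg₁, inertia_le_kerSubgroup_of_isUnramifiedOutside hκ₂ hne.symm h𝔓 hγ₁,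
    inertia_le_kerSubgroup_of_isUnramifiedOutside hκ₁ hne h𝔓' hγ₂, hg₂⟩

/-- **The doubly-adapted pair with generators in the CHOSEN inertia groups** `GreenbergSelmer.inertia v`,
`GreenbergSelmer.inertia vbar` (the currency of the crux's frames; `= I_{𝔓₀(w)}` for the tree's chosen prime
`adicCompletionPrime K w`, `inertia_adicCompletionPrime_eq_map_absInertia`). [cite: deShalit1987, II.4.17 (p. 77)]
[cite: Washington1997, Thm. 13.4] -/
theorem exists_isTopGeneratorPair_inertia_of_isUnramifiedOutside (hK : IsImaginaryQuadratic K)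
    (hh : ¬ p ∣ NumberField.classNumber K) {v vbar : HeightOneSpectrum (𝓞 K)} (hne : vbar ≠ v)
    {κ₁ κ₂ : ZpExtension K p} (hκ₁ : κ₁.IsUnramifiedOutside v) (hκ₂ : κ₂.IsUnramifiedOutside vbar) :
    ∃ γ₁ ∈ GreenbergSelmer.inertia v, ∃ γ₂ ∈ GreenbergSelmer.inertia vbar,
      ZpExtension.IsTopGeneratorPair κ₁ κ₂ γ₁ γ₂ := by
  obtain ⟨γ₁, hγ₁, γ₂, hγ₂, hpair⟩ := exists_isTopGeneratorPair_of_isUnramifiedOutside hK hh hne hκ₁ hκ₂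
    (adicCompletionPrime_mem_primesAbove K v) (adicCompletionPrime_mem_primesAbove K vbar)
  have e₁ : GreenbergSelmer.inertia v = (adicCompletionPrime K v).inertia (absoluteGaloisGroup K) :=
    (inertia_adicCompletionPrime_eq_map_absInertia K v).symm
  have e₂ : GreenbergSelmer.inertia vbar = (adicCompletionPrime K vbar).inertia (absoluteGaloisGroup K) :=
    (inertia_adicCompletionPrime_eq_map_absInertia K vbar).symm
  refine ⟨γ₁, ?_, γ₂, ?_, hpair⟩
  · rw [e₁]; exact hγ₁
  · rw [e₂]; exact hγ₂

/-- **EXISTENCE OF THE DOUBLY-ADAPTED PAIR AT A SPLIT PRIME** `p = v v̄` of an imaginary quadratic `K` with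
`p ∤ h_K`: `ℤ_p`-extensions `κ₁` unramified outside `v` and `κ₂` unramified outside `v̄` (class field theory,
`ZpExtension.exists_isUnramifiedOutside_of_split`) and `γ₁ ∈ I_v`, `γ₂ ∈ I_{v̄}` forming a generator pair of the
`ℤ_p²`-tower. [cite: deShalit1987, II.1.8, II.4.17 (p. 77)] [cite: Greenberg1978, §4 p. 94] [cite: Washington1997, §13.1, Thm. 13.4] -/
theorem exists_doublyAdapted_isTopGeneratorPair_of_split (hK : IsImaginaryQuadratic K)
    (hh : ¬ p ∣ NumberField.classNumber K) {v vbar : HeightOneSpectrum (𝓞 K)}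
    (hv : ((p : ℕ) : 𝓞 K) ∈ v.asIdeal) (hvbar : ((p : ℕ) : 𝓞 K) ∈ vbar.asIdeal) (hne : vbar ≠ v) :
    ∃ (κ₁ κ₂ : ZpExtension K p) (γ₁ γ₂ : absoluteGaloisGroup K),
      κ₁.IsUnramifiedOutside v ∧ κ₂.IsUnramifiedOutside vbar ∧
      γ₁ ∈ GreenbergSelmer.inertia v ∧ γ₂ ∈ GreenbergSelmer.inertia vbar ∧
      ZpExtension.IsTopGeneratorPair κ₁ κ₂ γ₁ γ₂ := by
  obtain ⟨κ₁, hκ₁⟩ := ZpExtension.exists_isUnramifiedOutside_of_split (p := p) hK hv hvbar hne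
  obtain ⟨κ₂, hκ₂⟩ := ZpExtension.exists_isUnramifiedOutside_of_split (p := p) hK hvbar hv hne.symm
  obtain ⟨γ₁, hγ₁, γ₂, hγ₂, hpair⟩ :=
    exists_isTopGeneratorPair_inertia_of_isUnramifiedOutside hK hh hne hκ₁ hκ₂
  exact ⟨κ₁, κ₂, γ₁, γ₂, hκ₁, hκ₂, hγ₁, hγ₂, hpair⟩

/-- **The `p = 2` display in the binder shape of the crux's frames** (`K` imaginary quadratic with
`¬ 2 ∣ h_K`, `2 ∈ v`, `2 ∈ v̄`, `v̄ ≠ v`): a doubly-adapted generator pair of the `ℤ₂²`-tower with `κ₁ = K(v^∞)`,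
`κ₂ = K*_∞ = K(v̄^∞)`, `γ₁ ∈ I_v`, `γ₂ ∈ I_{v̄}` exists. [cite: deShalit1987, II.4.17 (p. 77)] [cite: Agboola2007, §1 p. 1] -/
theorem exists_doublyAdapted_isTopGeneratorPair_two (hK : IsImaginaryQuadratic K)
    (hh : ¬ 2 ∣ NumberField.classNumber K) {v vbar : HeightOneSpectrum (𝓞 K)}
    (hv : ((2 : ℕ) : 𝓞 K) ∈ v.asIdeal) (hvbar : ((2 : ℕ) : 𝓞 K) ∈ vbar.asIdeal) (hne : vbar ≠ v) :
    ∃ (κ₁ κ₂ : ZpExtension K 2) (γ₁ γ₂ : absoluteGaloisGroup K),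
      κ₁.IsUnramifiedOutside v ∧ κ₂.IsUnramifiedOutside vbar ∧
      γ₁ ∈ GreenbergSelmer.inertia v ∧ γ₂ ∈ GreenbergSelmer.inertia vbar ∧
      ZpExtension.IsTopGeneratorPair κ₁ κ₂ γ₁ γ₂ :=
  exists_doublyAdapted_isTopGeneratorPair_of_split hK hh hv hvbar hne

/-! ### Appendix (append-only): the surjectivity form of total ramification -/

/-- **`κ(I_𝔓) = ℤ_p` for THE line unramified outside `v` (`p ∤ h_K`), surjectivity form**: every `x ∈ ℤ_p` is
`κ τ` for some `τ` in the inertia group `I_𝔓`, `𝔓 ∣ v` — a topological generator inside `I_𝔓`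
(`exists_mem_inertia_isTopGenerator_of_isUnramifiedOutside`) and the `ℤ_p`-saturation of the image of the closed
subgroup `I_𝔓` (`AnomalousLocalTorsion.exists_mem_apply_eq_ofAdd_mul`).  (E.g. the «`m = 0`» case of the
double-coset bookkeeping `σ = τ·γⁿ·h` over the line.) [cite: deShalit1987, II.1.8 and II.4.17 (p. 77)]
[cite: Washington1997, §13.1] -/
theorem exists_mem_inertia_apply_eq_of_isUnramifiedOutside (hK : IsImaginaryQuadratic K)
    (hh : ¬ p ∣ NumberField.classNumber K) {κ : ZpExtension K p} {v : HeightOneSpectrum (𝓞 K)}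
    (hκ : κ.IsUnramifiedOutside v) {𝔓 : Ideal (absIntegers (𝓞 K) K)} (h𝔓 : 𝔓 ∈ v.primesAbove)
    (x : ℤ_[p]) : ∃ τ ∈ 𝔓.inertia (absoluteGaloisGroup K), κ τ = Multiplicative.ofAdd x := by
  obtain ⟨τ₀, hτ₀, hgen⟩ := exists_mem_inertia_isTopGenerator_of_isUnramifiedOutside hK hh hκ h𝔓
  obtain ⟨τ, hτ, hκτ⟩ := AnomalousLocalTorsion.exists_mem_apply_eq_ofAdd_mul κ
    (𝔓.inertia (absoluteGaloisGroup K)) (absIntegers.isClosed_inertia_holds (R := 𝓞 K) (K := K) 𝔓) hτ₀ x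
  refine ⟨τ, hτ, ?_⟩
  rw [hκτ, show κ τ₀ = Multiplicative.ofAdd 1 from hgen, toAdd_ofAdd, mul_one]

/-- The same for the CHOSEN inertia group `GreenbergSelmer.inertia v`. [cite: deShalit1987, II.4.17 (p. 77)] -/
theorem exists_mem_inertia_apply_eq_of_isUnramifiedOutside' (hK : IsImaginaryQuadratic K)
    (hh : ¬ p ∣ NumberField.classNumber K) {κ : ZpExtension K p} {v : HeightOneSpectrum (𝓞 K)}
    (hκ : κ.IsUnramifiedOutside v) (x : ℤ_[p]) :
    ∃ τ ∈ GreenbergSelmer.inertia v, κ τ = Multiplicative.ofAdd x := by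
  have e : GreenbergSelmer.inertia v = (adicCompletionPrime K v).inertia (absoluteGaloisGroup K) :=
    (inertia_adicCompletionPrime_eq_map_absInertia K v).symm
  rw [e]
  exact exists_mem_inertia_apply_eq_of_isUnramifiedOutside hK hh hκ (adicCompletionPrime_mem_primesAbove K v) x

end Summit.BirchSwinnertonDyer.BirchSwinnertonDyer.Theorems.PrintCf2.DoublyAdaptedPair

end
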